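import Literature.AlgebraicGeometry.HodgeTheory.AtiyahClassCoherentNaturality
import Literature.Algebra.Homology.ExtClassNineDiagram
import HarnessLib

/-!
# The Atiyah class along a short exact sequence: `[S] ∘ At(E₊) = −At(E) ∘ [𝓗om(𝒯, S)]`

For an `S`-scheme `X : Over (Spec k)` and a short exact sequence of `𝒪_X`-modules
`S : 0 → E₊ →f E₋ →g E → 0`, the torsion-safe Atiyah classes
`At'(F) ∈ Ext¹(F, 𝓗om(𝒯, F))` of `HodgeTheory/AtiyahClassCoherent.lean` (`𝒯 = (Ω¹_{X/k})^∨`; `At'(F)`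
is the class of the jet sequence `0 → 𝓗om(𝒯, F) → P¹(F) → F → 0`) satisfy

* `extClass_comp_atiyahClass'_add_eq_zero` ∕ `extClass_comp_atiyahClass'_eq_neg`:
  `[S] ∘ At'(E₊) + At'(E) ∘ [𝓗om(𝒯, S)] = 0` in `Ext²(E, 𝓗om(𝒯, E₊))`, i.e.
  **`[S] ∘ At'(E₊) = −At'(E) ∘ [𝓗om(𝒯, S)]`**, as soon as the twisted sequence
  `𝓗om(𝒯, S) : 0 → 𝓗om(𝒯, E₊) → 𝓗om(𝒯, E₋) → 𝓗om(𝒯, E) → 0` is short exact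
  (Mathlib's `Ext.comp` is diagrammatic: `[S].comp At'(E₊)` is «`[S] ∈ Ext¹(E, E₊)` then `At'(E₊)`»);
* `shortExact_map_sheafHomFunctor_tangentSheaf`: the twisted sequence IS short exact when `𝒯` is
  finite locally free (e.g. `X → Spec k` smooth), by the exactness of `𝓗om(𝒯, –)`
  (`Modules/SheafHomExact.lean`); `…_of_isFiniteLocallyFree` are the corresponding unconditional forms.

This is the naturality of the Atiyah class with respect to the connecting morphism of `S` — the
degree-one companion of `atiyahClass'_naturality` (naturality along module maps,
`HodgeTheory/AtiyahClassCoherentNaturality.lean`): together they say that `At'` is a natural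
transformation `Id → 𝓗om(𝒯, –)[1]` compatible with triangles, which is how Buchweitz–Flenner
(Cor. 3.13: «the powers of the Atiyah class define morphisms of exact functors … that commute with
the shift functor», on `D⁻_coh(X)`) and Huybrechts–Thomas phrase it; here only the elementary
module-level instance `k = 1` is proved, directly from the jet sequences, with the sign explicit.
PROOF: the jet construction `P¹` is a functor (`jetMapCoh_comp`, `jetMapCoh_zero`,
`jetShortComplexCohMap_comp`, `jetShortComplexCohMap_zero`), so the three jet sequences of
`E₊, E₋, E` and the maps induced by `f, g` form a commutative `3 × 3` diagram with short exact rows,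
whose outer columns are `𝓗om(𝒯, S)` and `S`; the generic anticommutativity of the two composite
connecting classes of such a diagram (`Literature.Algebra.Homology.NineDiagram`, Cartan–Eilenberg
III.4.1) is exactly the claim. The sign is `−1` with Mathlib's conventions for `extClass` on both
sides (it does not depend on them).

No instance, no notation, no named fact (`def … : Prop`). Written for the venture `HSemireg`
(cell `pub-hsemireg`, seat s4-prove-1 g28, 2026-08-28): it is the primitive square (a-δ) consumed by
`Summit.Ventures.HSemireg.TwoLevelObstruction.NaturalAlong.ofComposite` (hypothesis `ha_δ` with
`εa = −1`). Nothing here says anything about the Hodge conjecture.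

## References

* R.-O. Buchweitz, H. Flenner, *A semiregularity map for modules and applications to
  deformations*, Compositio Math. 137 (2003), §3, Prop. 3.9 ∕ Cor. 3.13 (the powers of the Atiyah
  class are morphisms of exact functors commuting with the shift). [BuchweitzFlenner2003]
* D. Huybrechts, R. P. Thomas, *Deformation-obstruction theory for complexes via Atiyah and
  Kodaira–Spencer classes*, Math. Ann. 346 (2010), §2 (functoriality of Atiyah classes w.r.t.
  exact triangles). [HuybrechtsThomas2010]
* H. Cartan, S. Eilenberg, *Homological Algebra* (1956), Ch. III §4 Prop. 4.1. [CartanEilenberg1956]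
-/

noncomputable section

open CategoryTheory CategoryTheory.Abelian AlgebraicGeometry Opposite TopologicalSpace Limits

namespace Literature.AlgebraicGeometry.HodgeTheory

open Literature.AlgebraicGeometry.Modules Literature.AlgebraicGeometry.Motives
  Literature.Algebra.Homology

universe w u

variable {k : Type u} [CommRing k] {X : Over (Spec (CommRingCat.of k))}

/-! ### `P¹` is a functor: composition and zero -/

section Functoriality

variable {E E' E'' : X.left.Modules}

/-- Extensionality for torsion-safe jet sections (local copy; the library's is private). [folklore] -/
private lemma jetSectionsCoh_ext {F : X.left.Modules} {U : X.left.Opens} {p q : JetSectionsCoh F U}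
    (h₁ : p.fst = q.fst) (h₂ : p.snd = q.snd) : p = q :=
  Prod.ext h₁ h₂

/-- Restriction to the opens over `U` kills the zero morphism. [folklore] -/
private lemma overFunctor_map_zero (U : X.left.Opens) :
    (SheafOfModules.overFunctor _ U).map (0 : E ⟶ E') = 0 :=
  (Scheme.Modules.overFunctor (X := X.left) U).map_zero E E'

/-- **`P¹(f ≫ g) = P¹(f) ≫ P¹(g)`.** [cite: Atiyah1957, Prop. 6 (functoriality of D(E))] -/
theorem jetMapCoh_comp (f : E ⟶ E') (g : E' ⟶ E'') :
    jetMapCoh (f ≫ g) = jetMapCoh f ≫ jetMapCoh g :=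
  Scheme.Modules.hom_ext _ _ fun U => AddCommGrpCat.ext fun (p : JetSectionsCoh E U) =>
    jetSectionsCoh_ext rfl (by
      change p.snd ≫ (SheafOfModules.overFunctor _ U).map (f ≫ g) =
        (p.snd ≫ (SheafOfModules.overFunctor _ U).map f) ≫ (SheafOfModules.overFunctor _ U).map g
      rw [Functor.map_comp, Category.assoc])

/-- **`P¹(0) = 0`.** [cite: Atiyah1957, Prop. 6 (functoriality of D(E))] -/
theorem jetMapCoh_zero : jetMapCoh (0 : E ⟶ E') = 0 :=
  Scheme.Modules.hom_ext _ _ fun U => AddCommGrpCat.ext fun (p : JetSectionsCoh E U) =>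
    jetSectionsCoh_ext rfl (by
      change p.snd ≫ (SheafOfModules.overFunctor _ U).map (0 : E ⟶ E') = 0
      rw [overFunctor_map_zero, comp_zero])

/-- The morphism of Atiyah sequences is compatible with composition.
[cite: Atiyah1957, Prop. 6 (functoriality of 𝔅(E))] -/
theorem jetShortComplexCohMap_comp (f : E ⟶ E') (g : E' ⟶ E'') :
    jetShortComplexCohMap (f ≫ g) = jetShortComplexCohMap f ≫ jetShortComplexCohMap g :=
  ShortComplex.hom_ext _ _ (sheafHomMap_comp _ f g) (jetMapCoh_comp f g) rfl

/-- The morphism of Atiyah sequences induced by `0` is `0`. [cite: Atiyah1957, Prop. 6] -/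
theorem jetShortComplexCohMap_zero : jetShortComplexCohMap (0 : E ⟶ E') = 0 :=
  ShortComplex.hom_ext _ _ ((sheafHomFunctor (tangentSheaf X)).map_zero E E') jetMapCoh_zero rfl

end Functoriality

/-! ### The square with the connecting classes -/

section Connecting

variable {S : ShortComplex X.left.Modules}

/-- The two morphisms of Atiyah sequences induced by `S.f`, `S.g` compose to zero. [folklore] -/
private theorem jetShortComplexCohMap_f_comp_g :
    jetShortComplexCohMap S.f ≫ jetShortComplexCohMap S.g = 0 := by
  rw [← jetShortComplexCohMap_comp, S.zero, jetShortComplexCohMap_zero]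

/-- **`𝓗om(𝒯, S)` is short exact for `𝒯` finite locally free** (exactness of `𝓗om(𝒯, –)`,
`Modules/SheafHomExact.lean`). [cite: Hartshorne1977, III.6 (proof of Prop. 6.5) and II Ex. 5.1 (b)] -/
theorem shortExact_map_sheafHomFunctor_tangentSheaf (hS : S.ShortExact)
    (h𝒯 : IsFiniteLocallyFree (tangentSheaf X)) :
    (S.map (sheafHomFunctor (tangentSheaf X))).ShortExact :=
  have := preservesFiniteColimits_sheafHomFunctor (tangentSheaf X) h𝒯
  hS.map_of_exact _

variable [HasExt.{w} X.left.Modules]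

/-- The class `[𝓗om(𝒯, S)] ∈ Ext¹(𝓗om(𝒯, E), 𝓗om(𝒯, E₊))` of the twisted sequence, TYPED on the twisted
objects `twistTangentHom` (definitionally Mathlib's `hTS.extClass`, whose type is spelled with
`(S.map _).X₃ ∕ .X₁`; this spelling lets it compose with `atiyahClass'` without annotations). [folklore] -/
abbrev twistedExtClass (hTS : (S.map (sheafHomFunctor (tangentSheaf X))).ShortExact) :
    Ext.{w} (twistTangentHom S.X₃) (twistTangentHom S.X₁) 1 :=
  hTS.extClass

/-- **The Atiyah class anticommutes with connecting classes** (sum form): for a short exact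
sequence `S : 0 → E₊ → E₋ → E → 0` of `𝒪_X`-modules whose twist `𝓗om(𝒯, S)` is short exact,
`[S] ∘ At'(E₊) + At'(E) ∘ [𝓗om(𝒯, S)] = 0` in `Ext²(E, 𝓗om(𝒯, E₊))` (stated in every degree `n`
with a proof of `1 + 1 = n`). [cite: BuchweitzFlenner2003, Cor. 3.13 (`At` is a morphism of exact functors commuting with the shift; here its elementary instance k = 1 for a short exact sequence of modules, sign made explicit)] -/
theorem extClass_comp_atiyahClass'_add_eq_zero (hS : S.ShortExact)
    (hTS : (S.map (sheafHomFunctor (tangentSheaf X))).ShortExact) {n : ℕ} (h : 1 + 1 = n) :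
    hS.extClass.comp (atiyahClass'.{w} S.X₁) h +
      (atiyahClass'.{w} S.X₃).comp (twistedExtClass hTS) h = 0 :=
  NineDiagram.extClass_comp_extClass_add_eq_zero (jetShortComplexCohMap S.f)
    (jetShortComplexCohMap S.g) jetShortComplexCohMap_f_comp_g (jetShortComplexCoh_shortExact S.X₁)
    (jetShortComplexCoh_shortExact S.X₂) (jetShortComplexCoh_shortExact S.X₃) hTS hS h

/-- **`[S] ∘ At'(E₊) = −At'(E) ∘ [𝓗om(𝒯, S)]`** in `Ext²(E, 𝓗om(𝒯, E₊))`.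
[cite: BuchweitzFlenner2003, Cor. 3.13 (`At` is a morphism of exact functors commuting with the shift; here its elementary instance k = 1 for a short exact sequence of modules, sign made explicit)] -/
theorem extClass_comp_atiyahClass'_eq_neg (hS : S.ShortExact)
    (hTS : (S.map (sheafHomFunctor (tangentSheaf X))).ShortExact) {n : ℕ} (h : 1 + 1 = n) :
    hS.extClass.comp (atiyahClass'.{w} S.X₁) h =
      -(atiyahClass'.{w} S.X₃).comp (twistedExtClass hTS) h :=
  eq_neg_of_add_eq_zero_left (extClass_comp_atiyahClass'_add_eq_zero hS hTS h)

/-- The same with the sign as the unit `−1 ∈ ℤˣ` (the shape `ha_δ` of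
`Summit.Ventures.HSemireg.TwoLevelObstruction.NaturalAlong.ofComposite`, `εa = −1`).
[cite: BuchweitzFlenner2003, Cor. 3.13 (`At` is a morphism of exact functors commuting with the shift; here its elementary instance k = 1 for a short exact sequence of modules, sign made explicit)] -/
theorem extClass_comp_atiyahClass'_eq_units_smul (hS : S.ShortExact)
    (hTS : (S.map (sheafHomFunctor (tangentSheaf X))).ShortExact) {n : ℕ} (h : 1 + 1 = n) :
    hS.extClass.comp (atiyahClass'.{w} S.X₁) h =
      ((-1 : ℤˣ) : ℤ) • (atiyahClass'.{w} S.X₃).comp (twistedExtClass hTS) h := by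
  rw [Units.val_neg, Units.val_one, neg_one_zsmul]
  exact extClass_comp_atiyahClass'_eq_neg hS hTS h

/-- **`[S] ∘ At'(E₊) = −At'(E) ∘ [𝓗om(𝒯, S)]` for `𝒯` finite locally free** (e.g. `X → Spec k`
smooth): unconditional form. [cite: BuchweitzFlenner2003, Cor. 3.13 (`At` is a morphism of exact functors commuting with the shift; here its elementary instance k = 1 for a short exact sequence of modules, sign made explicit)] -/
theorem extClass_comp_atiyahClass'_eq_neg_of_isFiniteLocallyFree (hS : S.ShortExact)
    (h𝒯 : IsFiniteLocallyFree (tangentSheaf X)) {n : ℕ} (h : 1 + 1 = n) :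
    hS.extClass.comp (atiyahClass'.{w} S.X₁) h =
      -(atiyahClass'.{w} S.X₃).comp
        (twistedExtClass (shortExact_map_sheafHomFunctor_tangentSheaf hS h𝒯)) h :=
  extClass_comp_atiyahClass'_eq_neg hS _ h

end Connecting

end Literature.AlgebraicGeometry.HodgeTheory

end
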